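import Literature.NumberTheory.EllipticCurves.NewformCountMartinBoundProofs
import Literature.NumberTheory.EllipticCurves.HeightConductorBoundsExplicitInputsProofs
import Literature.NumberTheory.EllipticCurves.HeightConductorBoundsModularityAsymptoticProofs
import Literature.NumberTheory.EllipticCurves.HeightConductorBoundsModularityProofs
import Literature.Analysis.SpecialFunctions.EulerMascheroniBounds
import Mathlib.Analysis.Complex.ExponentialBounds
import HarnessLib

/-!
# von Känel–Matschke, Prop. 10.8 (ii) — PROVED: `β ≤ (1/6) ν log N + (1/16) ν log log log N + (1/9) ν`

Topic `Literature/NumberTheory/EllipticCurves` (family `abc`, LADDER-ABC A1: the *modular method*).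
A proofs-only companion (theorems only; NO definition, NO new named fact, nothing restated; D-0026)
of `HeightConductorBoundsModularity.lean`: the named fact `vonKanelMatschke_prop_10_8_ii` —
R. von Känel, B. Matschke, arXiv:1605.06079 = Mem. AMS **286** (2023) no. 1419
[`VonkanelMatschke2023`], **Prop. 10.8 (ii)**: *"It holds
`β ≤ (1/6) ν log N + (1/16) ν log log log N + (1/9) ν`, `ν ≤ N`"* (all `N ≥ 11`, as typed) — is
DISCHARGED: `vonKanelMatschke_prop_10_8_ii_holds`.

## The proof (printed proof of §10.5.3, over the tree)

With `m = newformCount N`, `l = vkmIndexL N`, `ν = condNu N`, `L = log N`: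

1. (eq:martinbound) `12 m ≤ ν + 1` — `twelve_mul_newformCount_le` (`NewformCountMartinBoundProofs`);
2. (eq:tau) `τ(n) ≤ 8.5 n^{1/4}` as `τ(n)⁴ ≤ 5092 n`, whence
   `β ≤ ½ m log m + m(¼ log 5092 + ¾ log l)` — the printed `β ≤ β' = m(½ log m + ¾ log l + log 8.5)`
   (`maxLogTauSum_le`, `HeightConductorBoundsExplicitInputsProofs`);
3. (eq:lbound) is replaced by the tree's PROVED Robin inequality for squarefree numbers (CLMS 2007,
   Thm. 1.1): `l ≤ (e^γ/6) N² log log N` unless `rad N ∈ {2,3,5,6,10,30}`, where `l ≤ (2/5) N²`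
   (`vkmIndexL_le_of_rad_not_mem`, `vkmIndexL_le_of_rad_mem`);
4. the printed assembly "`ν ≥ 6N/π²` and then (eq:martinbound) together with (eq:lbound) leads to
   `β' ≤ (ν/6) log N + (ν/16) log log log N + ν/9` for all `N ≥ 23`; one checks … `11 ≤ N < 23`" is
   carried out uniformly for all `N ≥ 11` (`vkmBeta_le_of_log_indexL_le` and the two cases): with
   `log m ≤ log((N+1)/12)`, `log(N+1) ≤ L + 1/N`, the main terms cancel exactly
   (`(ν+1)/12 · (½ + 3/2) L` against `ν L/6`) and the remainder `L/6 + (ν+1)/(24N) + L₃/16 + …` is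
   absorbed by `ν/9` using `ν ≥ N/2` (`half_le_condNu`), `ν ≥ 11` (from `m ≥ 1`), `L ≤ N/8 + log 8 − 1`,
   `−0.213 ≤ log log log N ≤ L − 2` and the numerical constants `log 2, log 3, log 5` (Mathlib, 9
   digits) and `γ < 0.57721571` (`EulerMascheroniBounds`). The case `m = 0` is `β = 0 ≤` RHS.
   The CLMS constant `e^γ` (for the printed `6e^γ/π²`) costs `¾ log(π²/6) ≈ 0.37` inside a bracket
   whose slack at `N = 11` is `≈ 1.2`; no printed constant is weakened.

Consequences (§6): the vKM §10.5 chain with the root (ii) removed — `2h(E) ≤ κ + ν/6 log N + …`,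
(eq:szpiro), `BakerShapeBound 1 1`, `EpsShapeBound 1` from modularity and Prop. 10.8 (i) alone.
No `abc` claim; typed ≠ endorsed. All theorems; axioms standard.

## References

* R. von Känel, B. Matschke, arXiv:1605.06079 (2016) = Mem. AMS 286 (2023), Prop. 10.8 (ii) and
  §10.5.3 (its proof). [VonkanelMatschke2023]
* Y. Choie, N. Lichiardopol, P. Moree, P. Solé, J. Théor. Nombres Bordeaux 19 (2007) 357–372, Thm. 1.1. [CLMS2007]
-/

noncomputable section

open Finset Real WeierstrassCurve
namespace Literature.NumberTheory.EllipticCurves.ModularForms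

/-! ### 1. Numerical constants (`log 2, log 3, log 5` to 9 digits from Mathlib) -/

/-- `log 12 ≥ 2.4849066`. [folklore] -/
private theorem log_twelve_ge : (2.4849066 : ℝ) ≤ Real.log 12 := by
  rw [show (12 : ℝ) = 2 ^ 2 * 3 by norm_num, Real.log_mul (by norm_num) (by norm_num), Real.log_pow]
  have := Real.log_two_gt_d9; have := Real.log_three_gt_d9
  push_cast; linarith

/-- `log 12 ≤ 2.4849067`. [folklore] -/
private theorem log_twelve_le : Real.log 12 ≤ 2.4849067 := by
  rw [show (12 : ℝ) = 2 ^ 2 * 3 by norm_num, Real.log_mul (by norm_num) (by norm_num), Real.log_pow]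
  have := Real.log_two_lt_d9; have := Real.log_three_lt_d9
  push_cast; linarith

/-- `log 6 ≥ 1.7917594`. [folklore] -/
private theorem log_six_ge : (1.7917594 : ℝ) ≤ Real.log 6 := by
  rw [show (6 : ℝ) = 2 * 3 by norm_num, Real.log_mul (by norm_num) (by norm_num)]
  have := Real.log_two_gt_d9; have := Real.log_three_gt_d9
  linarith

/-- `log 6 ≤ 1.7917595`. [folklore] -/
private theorem log_six_le : Real.log 6 ≤ 1.7917595 := by
  rw [show (6 : ℝ) = 2 * 3 by norm_num, Real.log_mul (by norm_num) (by norm_num)]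
  have := Real.log_two_lt_d9; have := Real.log_three_lt_d9
  linarith

/-- `log 5092 ≤ log 5120 = 10 log 2 + log 5 ≤ 8.5409098` (so `¼ log 5092 ≤ 2.1353 < log 8.5`). [folklore] -/
private theorem log_5092_le : Real.log 5092 ≤ 8.5409098 := by
  have h : Real.log 5092 ≤ Real.log 5120 := Real.log_le_log (by norm_num) (by norm_num)
  rw [show (5120 : ℝ) = 2 ^ 10 * 5 by norm_num, Real.log_mul (by norm_num) (by norm_num),
    Real.log_pow] at h
  have := Real.log_two_lt_d9; have := Real.log_five_lt_d9
  push_cast at h; linarith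

/-- `log(2/5) ≤ −0.9162907`. [folklore] -/
private theorem log_two_fifths_le : Real.log (2 / 5) ≤ -0.9162907 := by
  rw [Real.log_div (by norm_num) (by norm_num)]
  have := Real.log_two_lt_d9; have := Real.log_five_gt_d9
  linarith

/-- `log 8 ≤ 2.0794416`. [folklore] -/
private theorem log_eight_le : Real.log 8 ≤ 2.0794416 := by
  rw [show (8 : ℝ) = 2 ^ 3 by norm_num, Real.log_pow]
  have := Real.log_two_lt_d9
  push_cast; linarith

/-- `log 10 ≥ 2.302585`. [folklore] -/
private theorem log_ten_ge : (2.302585 : ℝ) ≤ Real.log 10 := by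
  rw [show (10 : ℝ) = 2 * 5 by norm_num, Real.log_mul (by norm_num) (by norm_num)]
  have := Real.log_two_gt_d9; have := Real.log_five_gt_d9
  linarith

/-! ### 2. Elementary logarithmic inequalities at `N ≥ 11` -/

/-- For `N ≥ 11`, with `L = log N`: `2.302585 ≤ L ≤ N/8 + 1.0794416`, `0.8245 ≤ log L ≤ L − 1`,
`−0.213 ≤ log log L ≤ L − 2`, `log(N+1) ≤ L + 1/N` (all from `1 − 1/x ≤ log x ≤ x − 1`).
[folklore] -/
private theorem log_bounds {N : ℕ} (hN : 11 ≤ N) :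
    2.302585 ≤ Real.log N ∧ Real.log N ≤ (N : ℝ) / 8 + 1.0794416 ∧
    0.8245 ≤ Real.log (Real.log N) ∧ Real.log (Real.log N) ≤ Real.log N - 1 ∧
    -0.213 ≤ Real.log (Real.log (Real.log N)) ∧
    Real.log (Real.log (Real.log N)) ≤ Real.log N - 2 ∧
    Real.log ((N : ℝ) + 1) ≤ Real.log N + 1 / N := by
  have hN' : (11 : ℝ) ≤ N := by exact_mod_cast hN
  set L := Real.log N with hL
  have h1 : 2.302585 ≤ L := le_trans log_ten_ge (Real.log_le_log (by norm_num) (by linarith))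
  have hLpos : 0 < L := by linarith
  have h2 : L ≤ (N : ℝ) / 8 + 1.0794416 := by
    have e : L = Real.log 8 + Real.log ((N : ℝ) / 8) := by
      rw [hL, ← Real.log_mul (by norm_num) (by positivity)]; congr 1; ring
    have := Real.log_le_sub_one_of_pos (show 0 < (N : ℝ) / 8 by positivity)
    have := log_eight_le
    linarith
  have h3 : 0.8245 ≤ Real.log L := by
    have e : Real.log L = Real.log 2 + Real.log (L / 2) := by
      rw [← Real.log_mul (by norm_num) (by positivity)]; congr 1; ring
    have h := Real.one_sub_inv_le_log_of_pos (show 0 < L / 2 by positivity)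
    have hinv : (L / 2)⁻¹ ≤ 2 / 2.302585 := by
      rw [inv_div]; exact div_le_div_of_nonneg_left (by norm_num) (by norm_num) h1
    have := Real.log_two_gt_d9
    linarith
  have hL2pos : 0 < Real.log L := by linarith
  have h4 : Real.log L ≤ L - 1 := Real.log_le_sub_one_of_pos hLpos
  have h5 : -0.213 ≤ Real.log (Real.log L) := by
    have h := Real.one_sub_inv_le_log_of_pos hL2pos
    have hinv : (Real.log L)⁻¹ ≤ 1 / 0.8245 := by
      rw [← one_div]; exact div_le_div_of_nonneg_left (by norm_num) (by norm_num) h3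
    linarith
  have h6 : Real.log (Real.log L) ≤ L - 2 := by
    have := Real.log_le_sub_one_of_pos hL2pos; linarith
  have h7 : Real.log ((N : ℝ) + 1) ≤ L + 1 / N := by
    have hN0 : (0 : ℝ) < N := by linarith
    have e : Real.log ((N : ℝ) + 1) = L + Real.log (((N : ℝ) + 1) / N) := by
      rw [hL, ← Real.log_mul (by positivity) (by positivity)]; congr 1; field_simp
    have h := Real.log_le_sub_one_of_pos (show 0 < ((N : ℝ) + 1) / N by positivity)
    have : ((N : ℝ) + 1) / N - 1 = 1 / N := by field_simp; ring
    linarith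
  exact ⟨h1, h2, h3, h4, h5, h6, h7⟩

/-! ### 3. `β ≤ (ν+1)/12 · (½ log(N+1) + (3/2) log N + ¼ log 5092 − ½ log 12 + ¾ D)` -/

/-- **The printed chain `β ≤ β' = m(½ log m + ¾ log l + log 8.5)`, `m ≤ (ν+1)/12`**, uniformly:
if `m ≥ 1` and `log l ≤ 2 log N + D`, then (with `log m ≤ log((ν+1)/12) ≤ log(N+1) − log 12`)
`β ≤ (ν+1)/12 · X`, `X = ½ log(N+1) + (3/2) log N + (¼ log 5092 − ½ log 12 + ¾ D) ≥ 0`.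
[cite: VonkanelMatschke2023, §10.5.3 (proof of Prop. 10.8 (ii): `β ≤ β'`, (eq:martinbound))] -/
theorem vkmBeta_le_of_log_indexL_le {N : ℕ} (hN : 2 ≤ N) (hm : 1 ≤ newformCount N) {D : ℝ}
    (hD : Real.log (vkmIndexL N) ≤ 2 * Real.log N + D)
    (hX : 0 ≤ 1 / 2 * Real.log ((N : ℝ) + 1) + 3 / 2 * Real.log N +
      (Real.log 5092 / 4 - Real.log 12 / 2 + 3 / 4 * D)) :
    vkmBeta N ≤ (condNu N + 1) / 12 * (1 / 2 * Real.log ((N : ℝ) + 1) + 3 / 2 * Real.log N +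
      (Real.log 5092 / 4 - Real.log 12 / 2 + 3 / 4 * D)) := by
  set m : ℝ := (newformCount N : ℝ) with hm'
  set X := 1 / 2 * Real.log ((N : ℝ) + 1) + 3 / 2 * Real.log N +
      (Real.log 5092 / 4 - Real.log 12 / 2 + 3 / 4 * D) with hX'
  have hm1 : (1 : ℝ) ≤ m := by rw [hm']; exact_mod_cast hm
  have hm0 : (0 : ℝ) ≤ m := by linarith
  have hmle : 12 * m ≤ condNu N + 1 := twelve_mul_newformCount_le hN
  have hνN : condNu N ≤ N := condNu_le_self N
  have hl1 : 1 ≤ vkmIndexL N := one_le_vkmIndexL hN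
  -- `β ≤ ½ m log m + m (¼ log 5092 + ¾ log l)`
  have hβ : vkmBeta N ≤ 1 / 2 * m * Real.log m +
      m * (Real.log 5092 / 4 + 3 / 4 * Real.log (vkmIndexL N)) := by
    have h := maxLogTauSum_le hl1 (newformCount N)
    unfold vkmBeta
    linarith
  -- `log m ≤ log(N+1) − log 12`
  have hlogm : Real.log m ≤ Real.log ((N : ℝ) + 1) - Real.log 12 := by
    have h1 : m ≤ ((N : ℝ) + 1) / 12 := by linarith
    have h2 := Real.log_le_log (by linarith) h1
    rwa [Real.log_div (by positivity) (by norm_num)] at h2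
  have hinner : 1 / 2 * Real.log m + (Real.log 5092 / 4 + 3 / 4 * Real.log (vkmIndexL N)) ≤ X := by
    rw [hX']; linarith
  have hβ2 : vkmBeta N ≤ m * X := by
    have h := mul_le_mul_of_nonneg_left hinner hm0
    have e : m * (1 / 2 * Real.log m + (Real.log 5092 / 4 + 3 / 4 * Real.log (vkmIndexL N))) =
        1 / 2 * m * Real.log m + m * (Real.log 5092 / 4 + 3 / 4 * Real.log (vkmIndexL N)) := by
      ring
    linarith
  calc vkmBeta N ≤ m * X := hβ2
    _ ≤ (condNu N + 1) / 12 * X := mul_le_mul_of_nonneg_right (by linarith) hX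

/-! ### 4. The three cases: `m = 0`; `rad N ∈ {2,3,5,6,10,30}`; the generic radical -/

/-- `m = 0`: then `β = 0` and the right-hand side is `≥ 0` (`log N ≥ 2.3`, `log log log N ≥ −0.213`).
[cite: VonkanelMatschke2023, Prop. 10.8 (ii)] -/
theorem vkmBeta_le_of_newformCount_eq_zero {N : ℕ} (hN : 11 ≤ N) (hm : newformCount N = 0) :
    vkmBeta N ≤ 1 / 6 * condNu N * Real.log N +
      1 / 16 * condNu N * Real.log (Real.log (Real.log N)) + 1 / 9 * condNu N := by
  have hl1 : 1 ≤ vkmIndexL N := one_le_vkmIndexL (by omega)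
  have hβ : vkmBeta N ≤ 0 := by
    have h := maxLogTauSum_le hl1 (newformCount N)
    unfold vkmBeta
    rw [hm] at h ⊢
    simp only [Nat.cast_zero, zero_mul, mul_zero, zero_add] at h ⊢
    exact h
  obtain ⟨hL1, -, -, -, hL31, -, -⟩ := log_bounds hN
  have hν0 : 0 ≤ condNu N := condNu_nonneg N
  have hpos : 0 ≤ 1 / 6 * Real.log N + 1 / 16 * Real.log (Real.log (Real.log N)) + 1 / 9 := by
    linarith
  have h := mul_nonneg hν0 hpos
  have e : condNu N * (1 / 6 * Real.log N + 1 / 16 * Real.log (Real.log (Real.log N)) + 1 / 9) =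
      1 / 6 * condNu N * Real.log N + 1 / 16 * condNu N * Real.log (Real.log (Real.log N)) +
        1 / 9 * condNu N := by ring
  linarith

/-- **The exceptional radical classes** (`rad N ∈ {2,3,5,6,10,30}`, `m ≥ 1`): `log l ≤ log(2/5) + 2 log N`,
so `D = log(2/5)` and the bracket constant is `¼ log 5092 − ½ log 12 + ¾ log(2/5) ≤ 0.2056`; the
remainder `L/6 + (ν+1)/(24N) + 0.2056 (ν+1)/12` is absorbed by `ν/9 + ν L₃/16` (`ν ≥ max(11, N/2)`,
`L₃ ≥ −0.213`). [cite: VonkanelMatschke2023, §10.5.3 (proof of Prop. 10.8 (ii))] -/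
theorem vkmBeta_le_of_rad_mem {N : ℕ} (hN : 11 ≤ N) (hm : 1 ≤ newformCount N)
    (hrad : ∏ p ∈ N.primeFactors, p ∈ ({2, 3, 5, 6, 10, 30} : Finset ℕ)) :
    vkmBeta N ≤ 1 / 6 * condNu N * Real.log N +
      1 / 16 * condNu N * Real.log (Real.log (Real.log N)) + 1 / 9 * condNu N := by
  have hN2 : 2 ≤ N := by omega
  have hN' : (11 : ℝ) ≤ N := by exact_mod_cast hN
  obtain ⟨hL1, hL2, -, -, hL31, -, hlog1⟩ := log_bounds hN
  have hνN : condNu N ≤ N := condNu_le_self N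
  have hν2 : (N : ℝ) / 2 ≤ condNu N := half_le_condNu (by omega)
  have hm1 : (1 : ℝ) ≤ newformCount N := by exact_mod_cast hm
  have hν11 : 11 ≤ condNu N := by have := twelve_mul_newformCount_le hN2; linarith
  have hν0 : 0 ≤ condNu N := by linarith
  -- `log l ≤ 2 L + log(2/5)`
  have hl1 : 1 ≤ vkmIndexL N := one_le_vkmIndexL hN2
  have hlpos : (0 : ℝ) < vkmIndexL N := by exact_mod_cast hl1
  have hD : Real.log (vkmIndexL N) ≤ 2 * Real.log N + Real.log (2 / 5) := by
    have h := vkmIndexL_le_of_rad_mem (by omega) hrad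
    have h2 := Real.log_le_log hlpos h
    rw [Real.log_mul (by norm_num) (by positivity), Real.log_pow] at h2
    push_cast at h2
    linarith
  have h12 := log_twelve_ge; have h12' := log_twelve_le; have h5092 := log_5092_le
  have h25 := log_two_fifths_le
  -- the bracket constant `K_B ≤ 0.2056`
  set K := Real.log 5092 / 4 - Real.log 12 / 2 + 3 / 4 * Real.log (2 / 5) with hK'
  have hK : K ≤ 0.2056 := by rw [hK']; linarith
  have hK0 : -2 ≤ K := by
    have : 0 ≤ Real.log 5092 := Real.log_nonneg (by norm_num)
    have : -0.92 ≤ Real.log (2 / 5) := by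
      rw [Real.log_div (by norm_num) (by norm_num)]
      have := Real.log_two_gt_d9; have := Real.log_five_lt_d9
      linarith
    rw [hK']; linarith
  have hlogN1 : 0 ≤ Real.log ((N : ℝ) + 1) := Real.log_nonneg (by linarith)
  have hX : 0 ≤ 1 / 2 * Real.log ((N : ℝ) + 1) + 3 / 2 * Real.log N + K := by linarith
  have hmain := vkmBeta_le_of_log_indexL_le hN2 hm hD hX
  -- remainder
  have b1 := mul_le_mul_of_nonneg_left hlog1 (show (0 : ℝ) ≤ (condNu N + 1) / 24 by positivity)
  have b2 : (condNu N + 1) / 24 * (1 / (N : ℝ)) ≤ 1 / 24 + 1 / 264 := by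
    rw [show (condNu N + 1) / 24 * (1 / (N : ℝ)) = (condNu N + 1) / (24 * N) by ring,
      div_le_iff₀ (by positivity)]
    nlinarith
  have b3 : (condNu N + 1) / 12 * K ≤ (condNu N + 1) / 12 * 0.2056 :=
    mul_le_mul_of_nonneg_left hK (by positivity)
  have b4 : condNu N * (-0.213) ≤ condNu N * Real.log (Real.log (Real.log N)) :=
    mul_le_mul_of_nonneg_left hL31 hν0
  have e : (condNu N + 1) / 12 * (1 / 2 * Real.log ((N : ℝ) + 1) + 3 / 2 * Real.log N + K) =
      (condNu N + 1) / 24 * Real.log ((N : ℝ) + 1) + (condNu N + 1) / 8 * Real.log N +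
        (condNu N + 1) / 12 * K := by ring
  rw [e] at hmain
  linarith [hmain, b1, b2, b3, b4, hν11, hν2, hνN, hL2, hL1]

/-- **The generic radical** (`rad N ∉ {2,3,5,6,10,30}`, `m ≥ 1`): `log l ≤ γ − log 6 + 2 log N + log log log N`
(CLMS), so `D = γ − log 6 + L₃`; the bracket constant `¼ log 5092 − ½ log 12 + ¾(γ − log 6) ≤ −0.018`
is dropped, the `L₃`-terms match up to `L₃/16`, and the remainder `L/6 + (ν+1)/(24N) + L₃/16` is
absorbed by `ν/9` (`ν ≥ max(11, N/2)`, `L₃ ≤ L − 2`, `L ≤ N/8 + 1.08`).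
[cite: VonkanelMatschke2023, §10.5.3 (proof of Prop. 10.8 (ii))] -/
theorem vkmBeta_le_of_rad_not_mem {N : ℕ} (hN : 11 ≤ N) (hm : 1 ≤ newformCount N)
    (hrad : ∏ p ∈ N.primeFactors, p ∉ ({2, 3, 5, 6, 10, 30} : Finset ℕ)) :
    vkmBeta N ≤ 1 / 6 * condNu N * Real.log N +
      1 / 16 * condNu N * Real.log (Real.log (Real.log N)) + 1 / 9 * condNu N := by
  have hN2 : 2 ≤ N := by omega
  have hN' : (11 : ℝ) ≤ N := by exact_mod_cast hN
  obtain ⟨hL1, hL2, hL21, -, hL31, hL32, hlog1⟩ := log_bounds hN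
  have hνN : condNu N ≤ N := condNu_le_self N
  have hν2 : (N : ℝ) / 2 ≤ condNu N := half_le_condNu (by omega)
  have hm1 : (1 : ℝ) ≤ newformCount N := by exact_mod_cast hm
  have hν11 : 11 ≤ condNu N := by have := twelve_mul_newformCount_le hN2; linarith
  have hν0 : 0 ≤ condNu N := by linarith
  have hγ := Literature.Analysis.SpecialFunctions.Real.eulerMascheroniConstant_lt_d8
  have hγ0 : 0 ≤ Real.eulerMascheroniConstant :=
    le_of_lt (lt_trans (by norm_num) Real.one_half_lt_eulerMascheroniConstant)
  -- `log l ≤ 2 L + (γ − log 6 + L₃)`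
  have hl1 : 1 ≤ vkmIndexL N := one_le_vkmIndexL hN2
  have hlpos : (0 : ℝ) < vkmIndexL N := by exact_mod_cast hl1
  have hL2pos : 0 < Real.log (Real.log N) := by linarith
  have hD : Real.log (vkmIndexL N) ≤ 2 * Real.log N +
      (Real.eulerMascheroniConstant - Real.log 6 + Real.log (Real.log (Real.log N))) := by
    have h := vkmIndexL_le_of_rad_not_mem hN2 hrad
    have h2 := Real.log_le_log hlpos h
    rw [Real.log_mul (by positivity) hL2pos.ne', Real.log_mul (by positivity) (by positivity),
      Real.log_div (by positivity) (by norm_num), Real.log_exp, Real.log_pow] at h2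
    push_cast at h2
    linarith
  have h12 := log_twelve_ge; have h12' := log_twelve_le; have h5092 := log_5092_le
  have h6 := log_six_ge; have h6' := log_six_le
  -- the bracket constant `K_A ≤ 0`
  set K := Real.log 5092 / 4 - Real.log 12 / 2 +
    3 / 4 * (Real.eulerMascheroniConstant - Real.log 6) with hK'
  have hK : K ≤ 0 := by rw [hK']; linarith
  have hK0 : -2.6 ≤ K := by
    have : 0 ≤ Real.log 5092 := Real.log_nonneg (by norm_num)
    rw [hK']; linarith
  have hlogN1 : 0 ≤ Real.log ((N : ℝ) + 1) := Real.log_nonneg (by linarith)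
  have eX : 1 / 2 * Real.log ((N : ℝ) + 1) + 3 / 2 * Real.log N +
      (Real.log 5092 / 4 - Real.log 12 / 2 +
        3 / 4 * (Real.eulerMascheroniConstant - Real.log 6 + Real.log (Real.log (Real.log N)))) =
      1 / 2 * Real.log ((N : ℝ) + 1) + 3 / 2 * Real.log N + K +
        3 / 4 * Real.log (Real.log (Real.log N)) := by rw [hK']; ring
  have hX : 0 ≤ 1 / 2 * Real.log ((N : ℝ) + 1) + 3 / 2 * Real.log N +
      (Real.log 5092 / 4 - Real.log 12 / 2 +
        3 / 4 * (Real.eulerMascheroniConstant - Real.log 6 + Real.log (Real.log (Real.log N)))) := by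
    rw [eX]; linarith
  have hmain := vkmBeta_le_of_log_indexL_le hN2 hm hD hX
  rw [eX] at hmain
  -- remainder
  have b1 := mul_le_mul_of_nonneg_left hlog1 (show (0 : ℝ) ≤ (condNu N + 1) / 24 by positivity)
  have b2 : (condNu N + 1) / 24 * (1 / (N : ℝ)) ≤ 1 / 24 + 1 / 264 := by
    rw [show (condNu N + 1) / 24 * (1 / (N : ℝ)) = (condNu N + 1) / (24 * N) by ring,
      div_le_iff₀ (by positivity)]
    nlinarith
  have b3 : (condNu N + 1) / 12 * K ≤ 0 :=
    mul_nonpos_of_nonneg_of_nonpos (by positivity) hK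
  have e : (condNu N + 1) / 12 * (1 / 2 * Real.log ((N : ℝ) + 1) + 3 / 2 * Real.log N + K +
      3 / 4 * Real.log (Real.log (Real.log N))) =
      (condNu N + 1) / 24 * Real.log ((N : ℝ) + 1) + (condNu N + 1) / 8 * Real.log N +
        (condNu N + 1) / 12 * K + (condNu N + 1) / 16 * Real.log (Real.log (Real.log N)) := by ring
  rw [e] at hmain
  linarith [hmain, b1, b2, b3, hν11, hν2, hνN, hL2, hL1, hL32]

/-! ### 5. Prop. 10.8 (ii), discharged -/

/-- **von Känel–Matschke, Prop. 10.8 (ii) — PROVED**: for every `N ≥ 11`,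
`β ≤ (1/6) ν log N + (1/16) ν log log log N + (1/9) ν` (the clause `ν ≤ N` is `condNu_le_self`).
Discharges the named fact `vonKanelMatschke_prop_10_8_ii`.
[cite: VonkanelMatschke2023, Prop. 10.8 (ii) (arXiv §10.5.2, prop:explbounds; proof §10.5.3)] -/
theorem vonKanelMatschke_prop_10_8_ii_holds : vonKanelMatschke_prop_10_8_ii := by
  intro N hN
  rcases Nat.eq_zero_or_pos (newformCount N) with hm | hm
  · exact vkmBeta_le_of_newformCount_eq_zero hN hm
  · by_cases hrad : ∏ p ∈ N.primeFactors, p ∈ ({2, 3, 5, 6, 10, 30} : Finset ℕ)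
    · exact vkmBeta_le_of_rad_mem hN hm hrad
    · exact vkmBeta_le_of_rad_not_mem hN hm hrad

/-! ### 6. Consequences: the vKM §10.5 chain with the root (ii) removed -/

/-- **Explicit Faltings-height bound from Prop. 10.8 (i) alone**: for `E/ℚ` of conductor `N ≥ 11`
(globally minimal `W` with a level-`N` datum), `2h(E) ≤ κ + (1/6)ν log N + (1/16)ν log₃ N + (1/9)ν`
(`two_mul_height_le_of_prop_10_8` with (ii) discharged).
[cite: VonkanelMatschke2023, Prop. 10.8 (i)–(ii) and the remark following it] -/
theorem two_mul_height_le_of_prop_10_8_i (hi : vonKanelMatschke_prop_10_8_i)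
    (W : WeierstrassCurve ℚ) [W.IsElliptic] [W.IsGloballyMinimal]
    (N : ℕ) [NeZero N] (hN : W.conductorNorm ℤ = N) (h11 : 11 ≤ N) (D : ModularParametrizationData W N) :
    2 * neronLatticeHeight D.L ≤ vkmKappa + (1 / 6 * condNu N * Real.log N +
      1 / 16 * condNu N * Real.log (Real.log (Real.log N)) + 1 / 9 * condNu N) :=
  two_mul_height_le_of_prop_10_8 hi vonKanelMatschke_prop_10_8_ii_holds W N hN h11 D

/-- **(eq:szpiro) from modularity and Prop. 10.8 (i) alone**: the named fact
`vonKanelMatschke_log_minimalDiscriminant_le` (`log Δ_E ≤ ν log N + 3/8 ν log₃N + 2/3 ν + 115.1`)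
follows from `nonempty_modularParametrizationData` and `vonKanelMatschke_prop_10_8_i`
(`log_minimalDiscriminant_le_of_prop_10_8` with (ii) discharged).
[cite: VonkanelMatschke2023, §10.5.3 display (eq:szpiro)] -/
theorem log_minimalDiscriminant_le_of_prop_10_8_i (hmod : nonempty_modularParametrizationData)
    (hi : vonKanelMatschke_prop_10_8_i) : vonKanelMatschke_log_minimalDiscriminant_le :=
  log_minimalDiscriminant_le_of_prop_10_8 hmod hi vonKanelMatschke_prop_10_8_ii_holds

/-- **`BakerShapeBound 1 1` from modularity and Prop. 10.8 (i) alone** (rung A1.P, vKM version, one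
root fewer). [cite: VonkanelMatschke2023, §10.4–§10.5 (Prop. 10.6 via (eq:szpiro) and Prop. 10.8)] -/
theorem bakerShapeBound_one_one_of_modularity_of_prop_10_8_i
    (hmod : nonempty_modularParametrizationData) (hi : vonKanelMatschke_prop_10_8_i) :
    Literature.Barriers.ABC.BakerShapeBound 1 1 :=
  bakerShapeBound_one_one_of_modularity_of_prop_10_8 hmod hi vonKanelMatschke_prop_10_8_ii_holds

/-- **`EpsShapeBound 1` (`log c ≪_ε rad^{1+ε}`) from modularity and Prop. 10.8 (i) alone** (rung
A1.P of LADDER-ABC in root-conditional kernel form, vKM version, with the analytic root (ii) now a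
theorem). [cite: VonkanelMatschke2023, §10.4–§10.5 (Prop. 10.6 via (eq:szpiro) and Prop. 10.8)] -/
theorem epsShapeBound_one_of_modularity_of_prop_10_8_i
    (hmod : nonempty_modularParametrizationData) (hi : vonKanelMatschke_prop_10_8_i) :
    Literature.Barriers.ABC.EpsShapeBound 1 :=
  epsShapeBound_one_of_modularity_of_prop_10_8 hmod hi vonKanelMatschke_prop_10_8_ii_holds

end Literature.NumberTheory.EllipticCurves.ModularForms
end
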